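import Literature.AlgebraicGeometry.Motives.ProetLimOneSequence
import Literature.AlgebraicGeometry.Motives.ProetCountableProducts
import Literature.Algebra.Homology.ExtPi
import HarnessLib

/-!
# Cohomology of `X_proét` commutes with countable products of coefficient groups (discharge)

Proof of the named fact `bijective_piComparison_proetCohomology` of `ProetLimOneSequence.lean`:
for every scheme `Y`, every sequence `(A_m)` of topological abelian groups and every `i`, the
comparison map `Hⁱ(Y_proét, F_{∏ A_m}) → ∏_m Hⁱ(Y_proét, F_{A_m})` is bijective. The three inputs:

* `proetSheafPiFanIsLimit` / `proetSheafPiIso_hom_π` — `F_{∏ A_m} = ∏_m F_{A_m}` in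
  `Shv(Y_proét, Ab)` compatibly with the projections (`C(U, ∏ A_m) = ∏ C(U, A_m)`, Bhatt–Scholze
  Lemma 4.2.12);
* `epi_piMap_of_epi` (`ProetCountableProducts.lean`) — countable products of epimorphisms of
  abelian sheaves on `Y_proét` are epimorphisms (Prop. 3.1.9, via the tower of Example 3.1.7 and
  Lemma 4.1.8 on Mathlib's site `Y.ProEt`);
* `Literature.Algebra.Homology.Ext.piComparison_bijective` (`ExtPi.lean`) — hence
  `Extⁱ(ℤ, ∏ F_m) = ∏ Extⁱ(ℤ, F_m)` by dimension shifting ("the product computes the derived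
  product", proof of Prop. 3.1.10).

## References

* B. Bhatt, P. Scholze, *The pro-étale topology for schemes*, Astérisque 369 (2015)
  (arXiv:1309.1198): Example 3.1.7, Prop. 3.1.9, Prop. 3.1.10 (proof), Lemma 4.1.8, Lemma 4.2.12.
  [BhattScholze2015]

## Design notes

* The product structure is proved for any index type `ι : Type` by `Fan.IsLimit.mk` directly in
  the sheaf category (lifts are `ContinuousMap.pi` sectionwise).
* Mathlib searches: `Sheaf.H.map_apply`, `Ext.mk₀_comp_mk₀`, `IsLimit.conePointUniqueUpToIso_hom_comp`;
  Literature: `ProetCohomology.piComparison`, `ProetCohomology.map_apply` (reused). Nothing restated.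
-/

universe w u

open CategoryTheory CategoryTheory.Limits Opposite AlgebraicGeometry

noncomputable section

-- `X.ProEt = MorphismProperty.Over @WeaklyEtale ⊤ X` feeds the class `@WeaklyEtale` where a
-- `MorphismProperty` is expected; as in Mathlib's `AlgebraicGeometry/Sites/Proetale.lean`, the
-- unifier must be allowed to unfold it when rewriting in goals mentioning objects of `X.ProEt`.
set_option backward.isDefEq.respectTransparency false

namespace Literature.AlgebraicGeometry.Motives

/-! ### The coefficient sheaf of a product is the product of the coefficient sheaves -/

section ProductSheaf

variable (X : Scheme.{u}) {ι : Type} (A : ι → Type) [∀ i, TopologicalSpace (A i)]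
  [∀ i, AddCommGroup (A i)] [∀ i, IsTopologicalAddGroup (A i)]

/-- The fan `(F_{∏ Aᵢ} → F_{Aᵢ})ᵢ` of pro-étale sheaves induced by the projections `∏ Aᵢ → Aᵢ`.
[folklore] -/
def proetSheafPiFan : Fan fun i => proetSheaf X (A i) :=
  Fan.mk (proetSheaf X (∀ i, A i)) fun i =>
    proetSheafMap X (Pi.evalAddMonoidHom A i) (continuous_apply i)

/-- Sections of `F_B` over `U`, as continuous maps `U → B` (the identity, fixing the type).
[folklore] -/
abbrev proetSection {B : Type} [TopologicalSpace B] [AddCommGroup B] [IsTopologicalAddGroup B]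
    {U : X.ProEtᵒᵖ} (y : (proetSheaf X B).obj.obj U) : C(U.unop.left, B) := y.down

/-- Restriction in `F_B` is composition of continuous maps (by `rfl`). [folklore] -/
theorem proetSection_map (B : Type) [TopologicalSpace B] [AddCommGroup B]
    [IsTopologicalAddGroup B] {U V : X.ProEtᵒᵖ} (g : U ⟶ V) (y : (proetSheaf X B).obj.obj U) :
    proetSection X ((proetSheaf X B).obj.map g y) = (proetSection X y).comp g.unop.left.base.hom :=
  rfl

variable {X A} in
/-- The lift `s.pt(U) → F_{∏ Aᵢ}(U) = C(U, ∏ Aᵢ)` of a fan `s` over the `F_{Aᵢ}`: a family of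
continuous maps `U → Aᵢ` is a continuous map `U → ∏ Aᵢ`. [folklore] -/
def proetSheafPiLiftApp (s : Fan fun i => proetSheaf X (A i)) (U : X.ProEtᵒᵖ) :
    (s.pt.obj.obj U) →+ (proetSheaf X (∀ i, A i)).obj.obj U where
  toFun x := ULift.up (ContinuousMap.pi fun i => proetSection X ((s.proj i).hom.app U x))
  map_zero' := by
    apply ULift.ext
    change ContinuousMap.pi (fun i => proetSection X ((s.proj i).hom.app U 0)) =
      (0 : C(U.unop.left, ∀ i, A i))
    refine ContinuousMap.ext fun a => funext fun i => ?_
    change proetSection X ((s.proj i).hom.app U 0) a = 0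
    rw [map_zero]
    rfl
  map_add' x y := by
    apply ULift.ext
    change ContinuousMap.pi (fun i => proetSection X ((s.proj i).hom.app U (x + y))) =
      ContinuousMap.pi (fun i => proetSection X ((s.proj i).hom.app U x)) +
        ContinuousMap.pi (fun i => proetSection X ((s.proj i).hom.app U y))
    refine ContinuousMap.ext fun a => funext fun i => ?_
    change proetSection X ((s.proj i).hom.app U (x + y)) a =
      proetSection X ((s.proj i).hom.app U x) a + proetSection X ((s.proj i).hom.app U y) a
    rw [map_add]
    rfl

variable {X A} in
/-- Components of the lift: `(lift x) a i = (s.proj i x) a` (by `rfl`). [folklore] -/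
theorem proetSheafPiLiftApp_apply (s : Fan fun i => proetSheaf X (A i)) (U : X.ProEtᵒᵖ)
    (x : s.pt.obj.obj U) (a : U.unop.left) (i : ι) :
    proetSection X (proetSheafPiLiftApp s U x) a i = proetSection X ((s.proj i).hom.app U x) a :=
  rfl

variable {X A} in
/-- The lift `s.pt → F_{∏ Aᵢ}` of a fan `s` over the `F_{Aᵢ}` as a morphism of sheaves. [folklore] -/
def proetSheafPiLift (s : Fan fun i => proetSheaf X (A i)) : s.pt ⟶ proetSheaf X (∀ i, A i) :=
  ObjectProperty.homMk
    { app := fun U => AddCommGrpCat.ofHom (proetSheafPiLiftApp s U)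
      naturality := fun U V g => by
        ext x
        apply ULift.ext
        change proetSection X (proetSheafPiLiftApp s V (s.pt.obj.map g x)) =
          proetSection X ((proetSheaf X (∀ i, A i)).obj.map g (proetSheafPiLiftApp s U x))
        refine ContinuousMap.ext fun a => funext fun i => ?_
        have h := ConcreteCategory.congr_hom ((s.proj i).hom.naturality g) x
        simp only [ConcreteCategory.comp_apply] at h
        rw [proetSheafPiLiftApp_apply, h]
        rfl }

/-- **`F_{∏ Aᵢ}` is the product of the `F_{Aᵢ}` in `Shv(X_proét, Ab)`**, with projections induced
by `∏ Aᵢ → Aᵢ`: sections of `F_B` over `U` are continuous maps `U → B`, and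
`C(U, ∏ Aᵢ) = ∏ C(U, Aᵢ)` (Bhatt–Scholze Lemma 4.2.12: `T ↦ F_T` commutes with limits of spaces).
[cite: BhattScholze2015, Lemma 4.2.12] -/
def proetSheafPiFanIsLimit : IsLimit (proetSheafPiFan X A) :=
  Fan.IsLimit.mk _ (fun s => proetSheafPiLift s)
    (fun s i => by
      apply ObjectProperty.hom_ext
      ext U x
      apply ULift.ext
      exact ContinuousMap.ext fun a => rfl)
    (fun s m hm => by
      apply ObjectProperty.hom_ext
      ext U x
      apply ULift.ext
      change proetSection X (m.hom.app U x) = proetSection X (proetSheafPiLiftApp s U x)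
      refine ContinuousMap.ext fun a => funext fun i => ?_
      have h := ConcreteCategory.congr_hom
        (congr_app (congrArg InducedCategory.Hom.hom (hm i)) U) x
      simp only [ObjectProperty.FullSubcategory.comp_hom, NatTrans.comp_app,
        ConcreteCategory.comp_apply] at h
      rw [proetSheafPiLiftApp_apply, ← h]
      rfl)

/-- The isomorphism `F_{∏ Aᵢ} ≅ ∏ F_{Aᵢ}` with the categorical product. [folklore] -/
def proetSheafPiIso : proetSheaf X (∀ i, A i) ≅ ∏ᶜ fun i => proetSheaf X (A i) :=
  (proetSheafPiFanIsLimit X A).conePointUniqueUpToIso (productIsProduct _)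

/-- Under `F_{∏ Aᵢ} ≅ ∏ F_{Aᵢ}`, the categorical projections are the maps induced by `∏ Aᵢ → Aᵢ`.
[folklore] -/
@[simp] theorem proetSheafPiIso_hom_π (i : ι) :
    (proetSheafPiIso X A).hom ≫ Pi.π _ i =
      proetSheafMap X (Pi.evalAddMonoidHom A i) (continuous_apply i) :=
  (proetSheafPiFanIsLimit X A).conePointUniqueUpToIso_hom_comp (productIsProduct _) ⟨i⟩

end ProductSheaf

/-! ### Discharge of the named fact -/

section Discharge

open Literature.Algebra.Homology

/-- Postcomposition with the class of an isomorphism is a bijection on `Ext`-groups. [folklore] -/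
theorem ext_comp_mk₀_iso_bijective {C : Type*} [Category C] [Abelian C] [HasExt.{w} C] {X Y Z : C}
    (e : Y ≅ Z) (n : ℕ) :
    Function.Bijective fun x : Abelian.Ext.{w} X Y n => x.comp (Abelian.Ext.mk₀ e.hom) (add_zero n) := by
  refine Function.bijective_iff_has_inverse.2
    ⟨fun y => y.comp (Abelian.Ext.mk₀ e.inv) (add_zero n), fun x => ?_, fun y => ?_⟩
  · simp only [Abelian.Ext.comp_assoc_of_third_deg_zero, Abelian.Ext.mk₀_comp_mk₀,
      Iso.hom_inv_id, Abelian.Ext.comp_mk₀_id]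
  · simp only [Abelian.Ext.comp_assoc_of_third_deg_zero, Abelian.Ext.mk₀_comp_mk₀,
      Iso.inv_hom_id, Abelian.Ext.comp_mk₀_id]

/-- **Cohomology of `X_proét` commutes with countable products of coefficient groups**
(discharge of `bijective_piComparison_proetCohomology`). Proof: `F_{∏ A_m} ≅ ∏_m F_{A_m}`
compatibly with the projections (`proetSheafPiIso_hom_π`); countable products of epimorphisms of
abelian sheaves on `Y_proét` are epimorphisms (`epi_piMap_of_epi`, Bhatt–Scholze Prop. 3.1.9 via
the tower argument of Example 3.1.7 and Lemma 4.1.8 on Mathlib's site `Y.ProEt`); hence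
`Extⁱ(ℤ, ∏ F_m) → ∏ Extⁱ(ℤ, F_m)` is bijective by dimension shifting (`Ext.piComparison_bijective`,
"the product computes the derived product", proof of Prop. 3.1.10), and the comparison map of
the fact is this bijection precomposed with the isomorphism.
[cite: BhattScholze2015, Prop. 3.1.9, Prop. 3.1.10 (proof), Example 3.1.7 and Lemma 4.1.8] -/
theorem bijective_piComparison_proetCohomology_holds :
    bijective_piComparison_proetCohomology.{u} := by
  intro Y A _ _ _ i
  have hepi : ∀ (F' G' : ℕ → Sheaf (Scheme.ProEt.topology Y) Ab.{u + 1}) (p : ∀ m, F' m ⟶ G' m),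
      (∀ m, Epi (p m)) → Epi (Limits.Pi.map p) := fun F' G' p hp => epi_piMap_of_epi p
  have hbij := Ext.piComparison_bijective hepi
    ((constantSheaf (Scheme.ProEt.topology Y) Ab.{u + 1}).obj (AddCommGrpCat.of (ULift ℤ)))
    (fun m => proetSheaf Y (A m)) i
  have key : ⇑(ProetCohomology.piComparison Y A i) =
      Ext.piComparison _ (fun m => proetSheaf Y (A m)) i ∘
        fun x => x.comp (Abelian.Ext.mk₀ (proetSheafPiIso Y A).hom) (add_zero i) := by
    funext x m
    change ProetCohomology.map Y (Pi.evalAddMonoidHom A m) (continuous_apply m) i x = _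
    rw [ProetCohomology.map_apply, Sheaf.H.map_apply, Function.comp_apply, Ext.piComparison_apply,
      Abelian.Ext.comp_assoc_of_third_deg_zero, Abelian.Ext.mk₀_comp_mk₀, proetSheafPiIso_hom_π]
  rw [key]
  exact hbij.comp (ext_comp_mk₀_iso_bijective _ i)

end Discharge

end Literature.AlgebraicGeometry.Motives

end
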